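import Summits.AtomisticToContinuum.BoseEinsteinCondensation.Theorems.BECGroundStateSOSIRModeCounting
import Summits.AtomisticToContinuum.BoseEinsteinCondensation.Theorems.BECThomsonPrincipleGDTransferWindowLaw
import Summits.AtomisticToContinuum.BoseEinsteinCondensation.Theorems.PeriodicIRBound.Negative.GroundOccupation
import HarnessLib

/-!
# Route BECFeynmanVortexArea, support item `MomentBoundCondensation` (stmt-AtomisticToContinuum-11846) —
# counting toolkit

Supports (does not close) stmt-AtomisticToContinuum-11846 (`…Theses.BECFeynmanVortexArea.MomentBoundCondensation`,
wanted verbatim also by route `BECNoCheapMomentum`); consumed by the closing file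
`BECFeynmanVortexAreaMomentBoundCondensation.lean`. Contents (all elementary):

* §1 the counting step in abstract form (`condensate_ge_half_of_sq`): Parseval `∑_k n_k = N`
  (`tsum_cellOccupation_planeWaveMode`), an infrared profile `n_k ≤ B₁ + B₂/‖k‖_∞²` on `0 < ‖k‖_∞ ≤ K`,
  the kinetic Markov bound off the window (`tsum_fracDispersion_two_mul_cellOccupation`), and the
  budget `26B₁K³ + 26B₂K ≤ N/4` give `⟨Ψ, n₀Ψ⟩ ≥ N/2` — the twin of `ModeCounting.condensate_ge_half`
  (profile `C/‖k‖_∞`) of `BECGroundStateSOSIRModeCounting.lean`; the `d = 3` lattice counts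
  `#{0 < ‖k‖_∞ ≤ M} ≤ 26M³`, `∑_{0<‖k‖_∞≤M} ‖k‖_∞⁻² ≤ 26M` (which make the infrared sum of the
  Wagner–Feynman bound `O(√ρ N)`) are reused from `BECThomsonPrincipleGDTransferWindowLaw.lean`;
* §2 the least slack over a finite set of modes (`exists_slack_of_groundOccupation_le`): bounds on the
  ground-state occupations `γ_N(k) = ⨅_δ ⨆_{δ-near-min} n_k` become bounds (factor `2`) on the
  occupations of all `δ`-near-minimisers for ONE `δ > 0`;
* §3 the Dyson–LSSY energy bound `E₀^per(N, L_N) ≤ 4πa(1 + C₁c₁)ρN` along `L_N = (N/ρ)^{1/3}`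
  (`periodicGroundStateEnergy_le_lssy`, the block of `IRModeCounting_proof` isolated; input: the
  vendored statement proved in `LSSY2005_upperBound_periodic_holds`).

References: LSSY2005 Thm. 2.2 (2.14) and §1.2 (1.17)–(1.19) (shape of the counting only).
-/

noncomputable section

open MeasureTheory Filter
open scoped ENNReal NNReal BigOperators

namespace Summit.AtomisticToContinuum.BoseEinsteinCondensation.Theorems.MomentBoundCondensation

open Literature.MathematicalPhysics.QuantumManyBody.BoseGas
open Summit.AtomisticToContinuum.BoseEinsteinCondensation.Theorems.PeriodicIRBound.Negative
  (groundOccupation)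
open Summit.AtomisticToContinuum.BoseEinsteinCondensation.Theorems.ModeCounting
open Summit.AtomisticToContinuum.BoseEinsteinCondensation.Cruxes.GDTransfer.DysonDressedWitness
  (card_latticeShell_le sum_inv_norm_sq_latticeShell_le)

/-! ## §1 The counting step in abstract form, profile `B₁ + B₂/‖k‖_∞²` -/

/-- **Mode counting on the torus with the moment-bound profile.** Let `Ψ` be a periodic `N`-body state
on the torus of side `L`, `n_k = ⟨φ_k, γ_Ψ φ_k⟩` its plane-wave occupations. Suppose (IR)
`n_k ≤ B₁ + B₂/‖k‖_∞²` for `0 < ‖k‖_∞ ≤ K`; (UV) `D ≤ |2πk/L|²` for `‖k‖_∞ > K`, with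
`D⁻¹⟨Ψ,HΨ⟩ ≤ N/4`; (window) `26B₁K³ + 26B₂K ≤ N/4`. Then `⟨Ψ, n₀Ψ⟩ ≥ N/2`, since by Parseval
`N = ∑_k n_k ≤ n₀ + ∑_{IR}(B₁ + B₂/‖k‖_∞²) + D⁻¹∑_k|2πk/L|²n_k ≤ n₀ + N/4 + N/4`.
[cite: LSSY2005, §1.2 (1.17)–(1.19)] -/
theorem condensate_ge_half_of_sq {N : ℕ} {L K B₁ B₂ : ℝ} (hL : 0 < L) (hK : 0 ≤ K) (hB₁ : 0 ≤ B₁)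
    (hB₂ : 0 ≤ B₂) (v : ℝ → ℝ≥0∞) (Ψ : PeriodicTrialState N L) {D : ℝ≥0∞} (hD0 : D ≠ 0)
    (hDtop : D ≠ ⊤)
    (hIR : ∀ k : Fin 3 → ℤ, k ≠ 0 → ‖(fun i : Fin 3 => ((k i : ℤ) : ℝ))‖ ≤ K →
      cellOccupation N L (planeWaveMode L k) Ψ.ψ ≤ ENNReal.ofReal (B₁ + B₂ / ‖(fun i : Fin 3 => ((k
          i : ℤ) : ℝ))‖ ^ 2))
    (hUV : ∀ k : Fin 3 → ℤ, K < ‖(fun i : Fin 3 => ((k i : ℤ) : ℝ))‖ → D ≤ fracDispersion 2 L k)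
    (hT : D⁻¹ * periodicEnergy v Ψ ≤ ENNReal.ofReal (N / 4))
    (hW : B₁ * (26 * K ^ 3) + B₂ * (26 * K) ≤ N / 4) :
    ENNReal.ofReal (1 / 2 * N) ≤ condensateOccupation N L Ψ.ψ := by
  classical
  set n : (Fin 3 → ℤ) → ℝ≥0∞ := fun k => cellOccupation N L (planeWaveMode L k) Ψ.ψ with hn
  set M : ℕ := ⌊K⌋₊ with hM
  set S : Finset (Fin 3 → ℤ) := ((Fintype.piFinset fun _ : Fin 3 => Finset.Icc (-((M : ℕ) : ℤ)) ((M
      : ℕ) : ℤ))).erase 0 with hS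
  -- pointwise three-way bound: zero mode / infrared window / ultraviolet tail
  have hpt : ∀ k, n k ≤ (if k = 0 then n k else 0) +
      (if k ∈ S then ENNReal.ofReal (B₁ + B₂ / ‖(fun i : Fin 3 => ((k i : ℤ) : ℝ))‖ ^ 2) else 0) +
        D⁻¹ * (fracDispersion 2 L k * n k) := by
    intro k
    by_cases hk0 : k = 0
    · rw [if_pos hk0]
      exact le_add_right (le_add_right le_rfl)
    · by_cases hkK : ‖(fun i : Fin 3 => ((k i : ℤ) : ℝ))‖ ≤ K
      · have hkS : k ∈ S := Finset.mem_erase.2 ⟨hk0, mem_latticeBox_floor_of_norm_le hkK⟩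
        rw [if_neg hk0, if_pos hkS, zero_add]
        exact le_add_right (hIR k hk0 hkK)
      · push Not at hkK
        refine le_add_left ?_
        calc n k = D⁻¹ * D * n k := by rw [ENNReal.inv_mul_cancel hD0 hDtop, one_mul]
          _ ≤ D⁻¹ * fracDispersion 2 L k * n k := by gcongr; exact hUV k hkK
          _ = D⁻¹ * (fracDispersion 2 L k * n k) := mul_assoc _ _ _
  -- the infrared window carries at most `N/4`
  have hMK : (M : ℝ) ≤ K := Nat.floor_le hK
  have hIRsum : ∑ k ∈ S, ENNReal.ofReal (B₁ + B₂ / ‖(fun i : Fin 3 => ((k i : ℤ) : ℝ))‖ ^ 2) ≤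
      ENNReal.ofReal (N / 4) := by
    rw [← ENNReal.ofReal_sum_of_nonneg (fun k _ => by positivity)]
    refine ENNReal.ofReal_le_ofReal ?_
    calc ∑ k ∈ S, (B₁ + B₂ / ‖(fun i : Fin 3 => ((k i : ℤ) : ℝ))‖ ^ 2)
        = B₁ * (S.card : ℝ) + B₂ * ∑ k ∈ S, 1 / ‖(fun i : Fin 3 => ((k i : ℤ) : ℝ))‖ ^ 2 := by
          rw [Finset.sum_add_distrib, Finset.sum_const, nsmul_eq_mul, Finset.mul_sum]
          congr 1
          · ring
          · exact Finset.sum_congr rfl fun k _ => by rw [mul_one_div]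
      _ ≤ B₁ * (26 * (M : ℝ) ^ 3) + B₂ * (26 * M) := by
          gcongr
          · exact card_latticeShell_le M
          · exact sum_inv_norm_sq_latticeShell_le M
      _ ≤ B₁ * (26 * K ^ 3) + B₂ * (26 * K) := by gcongr
      _ ≤ N / 4 := hW
  -- the ultraviolet tail carries at most `N/4`
  have hTsum : D⁻¹ * ∑' k, fracDispersion 2 L k * n k ≤ ENNReal.ofReal (N / 4) := by
    refine le_trans ?_ hT
    gcongr
    calc ∑' k, fracDispersion 2 L k * n k = ∫⁻ X in cellN N L, kineticDensity Ψ.ψ X :=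
          tsum_fracDispersion_two_mul_cellOccupation hL Ψ
      _ ≤ periodicEnergy v Ψ := lintegral_mono fun X => le_self_add
  -- Parseval and summation of the pointwise bound
  have hS' : ∑ k ∈ S, (if k ∈ S then ENNReal.ofReal (B₁ + B₂ / ‖(fun i : Fin 3 => ((k i : ℤ) : ℝ))‖
      ^ 2) else 0) =
      ∑ k ∈ S, ENNReal.ofReal (B₁ + B₂ / ‖(fun i : Fin 3 => ((k i : ℤ) : ℝ))‖ ^ 2) :=
    Finset.sum_congr rfl fun k hk => if_pos hk
  have hsum : (N : ℝ≥0∞) ≤ n 0 + ENNReal.ofReal (N / 4) + ENNReal.ofReal (N / 4) := by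
    calc (N : ℝ≥0∞) = ∑' k, n k := (Ψ.tsum_cellOccupation_planeWaveMode hL).symm
      _ ≤ ∑' k, ((if k = 0 then n k else 0) +
          (if k ∈ S then ENNReal.ofReal (B₁ + B₂ / ‖(fun i : Fin 3 => ((k i : ℤ) : ℝ))‖ ^ 2) else
              0) +
            D⁻¹ * (fracDispersion 2 L k * n k)) := ENNReal.tsum_le_tsum hpt
      _ = n 0 + ∑ k ∈ S, ENNReal.ofReal (B₁ + B₂ / ‖(fun i : Fin 3 => ((k i : ℤ) : ℝ))‖ ^ 2) +
          D⁻¹ * ∑' k, fracDispersion 2 L k * n k := by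
          rw [ENNReal.tsum_add, ENNReal.tsum_add, tsum_ite_eq 0 n, ENNReal.tsum_mul_left,
            tsum_eq_sum (s := S) fun k hk => if_neg hk, hS']
      _ ≤ n 0 + ENNReal.ofReal (N / 4) + ENNReal.ofReal (N / 4) := by gcongr
  -- conclusion: `N/2 + N/2 ≤ n₀ + N/2`
  have h2 : ENNReal.ofReal (1 / 2 * N) + ENNReal.ofReal (1 / 2 * N) = (N : ℝ≥0∞) := by
    rw [← ENNReal.ofReal_add (by positivity) (by positivity), ← ENNReal.ofReal_natCast]
    exact congrArg ENNReal.ofReal (by ring)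
  have h4 : ENNReal.ofReal ((N : ℝ) / 4) + ENNReal.ofReal ((N : ℝ) / 4) =
      ENNReal.ofReal (1 / 2 * N) := by
    rw [← ENNReal.ofReal_add (by positivity) (by positivity)]
    exact congrArg ENNReal.ofReal (by ring)
  have hhalf : ENNReal.ofReal (1 / 2 * N) + ENNReal.ofReal (1 / 2 * N) ≤
      n 0 + ENNReal.ofReal (1 / 2 * N) := by
    rw [h2, ← h4, ← add_assoc]
    exact hsum
  have h0 : n 0 = condensateOccupation N L Ψ.ψ := cellOccupation_planeWaveMode_zero N L Ψ.ψ
  rw [← h0]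
  exact ENNReal.le_of_add_le_add_right ENNReal.ofReal_ne_top hhalf

/-! ## §2 The least slack over the finite window -/

/-- From bounds on the ground-state occupations `γ_N(k) ≤ b_k` (`b_k > 0`) for the modes of a finite
set `W ⊂ ℤ³` to ONE slack `δ > 0` at which every `δ`-near-minimiser has `n_k ≤ 2b_k` for all `k ∈ W`
(pick `δ_k` with `⨆_{δ_k-near-min} n_k < 2b_k` by `iInf_lt_iff`, take the least one). [folklore] -/
theorem exists_slack_of_groundOccupation_le {v : ℝ → ℝ≥0∞} {N : ℕ} {L : ℝ}
    (W : Finset (Fin 3 → ℤ)) (hW : W.Nonempty) (b : (Fin 3 → ℤ) → ℝ) (hb : ∀ k ∈ W, 0 < b k)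
    (h : ∀ k ∈ W, groundOccupation v N L k ≤ ENNReal.ofReal (b k)) :
    ∃ δ : ℝ≥0∞, 0 < δ ∧ ∀ Ψ : PeriodicTrialState N L,
      periodicEnergy v Ψ ≤ periodicGroundStateEnergy v N L + δ →
        ∀ k ∈ W, cellOccupation N L (planeWaveMode L k) Ψ.ψ ≤ ENNReal.ofReal (2 * b k) := by
  classical
  -- a slack for each mode
  have hk : ∀ k : Fin 3 → ℤ, ∃ δ : ℝ≥0∞, 0 < δ ∧ (k ∈ W →
      ∀ Ψ : PeriodicTrialState N L, periodicEnergy v Ψ ≤ periodicGroundStateEnergy v N L + δ →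
        cellOccupation N L (planeWaveMode L k) Ψ.ψ ≤ ENNReal.ofReal (2 * b k)) := by
    intro k
    by_cases hkw : k ∈ W
    · have hlt : groundOccupation v N L k < ENNReal.ofReal (2 * b k) := by
        refine (h k hkw).trans_lt ?_
        rw [ENNReal.ofReal_lt_ofReal_iff (by linarith [hb k hkw])]
        linarith [hb k hkw]
      obtain ⟨δ, hδlt⟩ := iInf_lt_iff.1 hlt
      obtain ⟨hδ, hsup⟩ := iInf_lt_iff.1 hδlt
      refine ⟨δ, hδ, fun _ Ψ hΨ => ?_⟩
      exact (le_iSup₂_of_le (f := fun (Φ : PeriodicTrialState N L)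
        (_ : periodicEnergy v Φ ≤ periodicGroundStateEnergy v N L + δ) =>
          cellOccupation N L (planeWaveMode L k) Φ.ψ) Ψ hΨ le_rfl).trans hsup.le
    · exact ⟨1, one_pos, fun h' => (hkw h').elim⟩
  choose δf hδf hprop using hk
  refine ⟨W.inf' hW δf, (Finset.lt_inf'_iff hW).2 fun k _ => hδf k, fun Ψ hΨ k hkW => ?_⟩
  have hle : W.inf' hW δf ≤ δf k := Finset.inf'_le _ hkW
  exact hprop k hkW Ψ (hΨ.trans (add_le_add le_rfl hle))

/-! ## §3 The energy bound along the thermodynamic boxes (Dyson–LSSY) -/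

/-- **`E₀^per(N, L_N) ≤ 4πa(1 + C₁c₁)ρN` along `L_N = (N/ρ)^{1/3}`** for `N ≥ 2`, `L_N > 2R`, and
`ρ < 3(c₁/(a+1))³/(4π)`, from the vendored LSSY Thm. 2.2 statement with constants `C₁, c₁`
(`ρ₁ = (N-1)/L³ ≤ ρ`, `a/b ≤ (a+1)(4πρ/3)^{1/3} < c₁`). The block of `IRModeCounting_proof`, isolated.
[cite: LSSY2005, Thm. 2.2 (2.14)] -/
theorem periodicGroundStateEnergy_le_lssy {v : ℝ → ℝ≥0∞} {R C₁ c₁ : ℝ} (hC₁ : 0 < C₁)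
    (hLSSY : ∀ (N : ℕ) (L : ℝ), 2 ≤ N → 0 < L → 2 * R < L →
      let a := (scatteringLength v).toReal
      let ρ₁ := ((N : ℝ) - 1) / L ^ 3
      let b := (4 * Real.pi * ρ₁ / 3) ^ (-(1 : ℝ) / 3)
      a / b ≤ c₁ →
      periodicGroundStateEnergy v N L ≤
        ENNReal.ofReal (4 * Real.pi * ρ₁ * a * (1 + C₁ * (a / b)) * N))
    {ρ : ℝ} (hρ : 0 < ρ)
    (hsmall : ((scatteringLength v).toReal + 1) * (4 * Real.pi * ρ / 3) ^ ((1 : ℝ) / 3) < c₁)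
    {N : ℕ} (hN2 : 2 ≤ N) (hRL : 2 * R < sideLength ρ N) :
    periodicGroundStateEnergy v N (sideLength ρ N) ≤
      ENNReal.ofReal (4 * Real.pi * (scatteringLength v).toReal * (1 + C₁ * c₁) * ρ * N) := by
  set a : ℝ := (scatteringLength v).toReal with ha
  have ha0 : 0 ≤ a := ENNReal.toReal_nonneg
  have hN : 0 < N := lt_of_lt_of_le two_pos hN2
  have hNr : (0 : ℝ) < N := Nat.cast_pos.2 hN
  set L : ℝ := sideLength ρ N with hLdef
  have hL : 0 < L := Real.rpow_pos_of_pos (div_pos hNr hρ) _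
  have hL3 : ρ * L ^ 3 = N := by
    rw [hLdef, Literature.MathematicalPhysics.QuantumManyBody.BoseGas.sideLength_pow_three hρ N]
    field_simp
  have hc₁ : 0 < c₁ := lt_of_le_of_lt (by positivity) hsmall
  have hL1 := hLSSY N L hN2 hL hRL
  simp only [] at hL1
  set ρ₁ : ℝ := ((N : ℝ) - 1) / L ^ 3 with hρ₁
  have hN2r : (2 : ℝ) ≤ N := by exact_mod_cast hN2
  have hρ₁0 : 0 ≤ ρ₁ := div_nonneg (by linarith) (by positivity)
  have hρ₁ρ : ρ₁ ≤ ρ := by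
    rw [hρ₁, div_le_iff₀ (by positivity), hL3]
    linarith
  have hx : a * (4 * Real.pi * ρ₁ / 3) ^ ((1 : ℝ) / 3) ≤ c₁ := by
    have h1 : (4 * Real.pi * ρ₁ / 3) ^ ((1 : ℝ) / 3) ≤ (4 * Real.pi * ρ / 3) ^ ((1 : ℝ) / 3) :=
      Real.rpow_le_rpow (by positivity) (by gcongr) (by norm_num)
    calc a * (4 * Real.pi * ρ₁ / 3) ^ ((1 : ℝ) / 3)
        ≤ (a + 1) * (4 * Real.pi * ρ / 3) ^ ((1 : ℝ) / 3) :=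
          mul_le_mul (by linarith) h1 (by positivity) (by positivity)
      _ ≤ c₁ := hsmall.le
  have hL2 := hL1 (by rw [div_rpow_neg_third (by positivity)]; exact hx)
  rw [div_rpow_neg_third (by positivity)] at hL2
  refine hL2.trans (ENNReal.ofReal_le_ofReal ?_)
  calc 4 * Real.pi * ρ₁ * a * (1 + C₁ * (a * (4 * Real.pi * ρ₁ / 3) ^ ((1 : ℝ) / 3))) * N
      ≤ 4 * Real.pi * ρ * a * (1 + C₁ * c₁) * N := by gcongr
    _ = 4 * Real.pi * a * (1 + C₁ * c₁) * ρ * N := by ring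

end Summit.AtomisticToContinuum.BoseEinsteinCondensation.Theorems.MomentBoundCondensation

end
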